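/-
COR-CM (cell pub-hodgecm2, stage 2 of the Hodge ladder) — count-neutral KERNEL COMBINATORICS «index-two lifting: the Hodge lattice of an index-two
extension is generated by the lifts of a generating family of the subgroup plus the mixed faces» (seat prover-pub-hodgecm2-b23-g46-0, binder prover
b23, gen 46; claim «SPLIT INDEX-TWO», HOME/INBOX.md l.20957).  Theorems only, on top of gen 41ʼs
`Census/IndexTwoDescent{Dictionary,Hodge,Mixed,Stable,Blocks}` and b09ʼs `Census/TwistGenerationDescent` BY NAME; no `decide`, no certificate, no
named fact, no `sorry`; `Interfaces.lean` (C1), every E term, B01, `Transposition/*`, `PortJoin/*`, `D2Bridge/*` untouched.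
HONEST FRAMING: `HC_CM` is NOT proved, here or anywhere in the tree; nothing here is a period, a count of record or a headline.
T5: n/a-class (hypothesis binders: `c * c = 1`, `c ≠ 1`, `c` central, `c ∈ H`, `H.index = 2`, `x ∉ H`, a generation hypothesis on `H`); checker: self.
-/
import Summits.HodgeConjecture.CorCM.Census.IndexTwoDescentStable
import Summits.HodgeConjecture.CorCM.Census.IndexTwoDescentBlocks
import Summits.HodgeConjecture.CorCM.Census.TwistGenerationDescent

/-!
# Index-two lifting: `μ(G, c) ≤ μ(H, c) + μ_mixed(G, c)`

Let `G` be a finite group, `c ∈ G` a CENTRAL involution `≠ 1`, `H ≤ G` a subgroup of INDEX TWO containing `c` and `x ∈ G ∖ H` — NO splitting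
hypothesis (`x·x` arbitrary): dihedral, dicyclic / generalised quaternion, semidihedral, modular, every `K × ℤ/2` over `K`, `Q₈ ⊃ ℤ/4`, … .
Gen 41ʼs index-two descent (`Census/IndexTwoDescent*`) identifies the types of `(G, c)` with pairs of types of `(H, c)` (`typePairEquiv`), the
Hodge lattice with the vectors whose two MARGINALS `marg₀ = (res₀)_*`, `marg₁ = (res₁)_*` are Hodge (`mem_hodgeSpan_iff_marg`), and the span of the
MIXED faces (one place in `H`, one in `xH`) with the bi-marginal-zero lattice `Z = ker marg₀ ⊓ ker marg₁` (`span_mixed_eq`), a `ℤ[G]`-module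
(`mapDomain_rt_mem_ker_inf_ker`).

THIS FILE lifts a generating family of `(H, c)` to `(G, c)`:

* §1 the marginals of base changes along `x`: `marg₁ (y·x⁻¹) = (pushTwist)_* (marg₀ y)` (`marg₁_mapDomain_rt_x`), so a vector with zero
  `0`-marginal becomes a vector with zero `1`-marginal after the base change along `x` (`marg₁_mapDomain_rt_x_eq_zero`);
* §2 three lifting lemmas — translates of lifts realise `(ℤ[H]·S, 0)` on the marginals (`exists_lift_of_mem_span_translates`), pairs of `G` realise
  `(pair, ·)` (`exists_pair_lift_of_mem_span_pairSet`) and, with the `1`-marginal pinned to `0`, `(pair − pair T⋆, 0)` (`exists_pair_lift_sub_of_mem_span_pairSet`);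
* §3 **THE LIFTING THEOREM** `hodgeSpan_le_sup_ker_of_lifts`: if `hodgeSpan (H,c) ≤ ℤ⟨pairs⟩ ⊔ ℤ⟨translates S⟩` and every `f ∈ S` has a lift
  `F ∈ M` (`marg₀ F = f`, `marg₁ F = 0`) in a base-change-stable submodule `M ≤ hodgeSpan (G,c)`, then
  **`hodgeSpan (G,c) ≤ (ℤ⟨pairs⟩ ⊔ M) ⊔ Z`** — proof: kill the `0`-marginal of a Hodge vector by lifts and pairs, move to `y·x⁻¹` (zero `1`-marginal),
  kill its `0`-marginal by lifts and DIFFERENCES of pairs (the constant type sum forces the residual multiple of `pair T⋆` to vanish), move back;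
* §4 **THE FACE FORM** `exists_lifts_hodgeSpan_le`: for `S ⊆ gfaceSet (H,c)` finite with `hodgeSpan (H,c) ≤ ℤ⟨pairs⟩ ⊔ ℤ⟨translates S⟩` there is
  `𝓕 ⊆ gfaceSet (G,c)` with `|𝓕| ≤ |S|` and **`hodgeSpan (G,c) ≤ (ℤ⟨pairs⟩ ⊔ ℤ⟨translates 𝓕⟩) ⊔ ℤ⟨mixed faces⟩`**: the lift of the face
  `gface T t t'` of `H` is the face `gface (glue T T) t t'` of `G` at the diagonal type (`marg₀_gface_glue`, `gface_glue_mem_gfaceSet`).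
  In census words: **`μ(G, c) ≤ μ(H, c) + μ_mixed(G, c)`**, the whole face census of an index-two extension reduces to its mixed module `Z`.

## References
* [Pohlmann1968] H. Pohlmann, Algebraic cycles on abelian varieties of complex multiplication type, Ann. of Math. 88 (1968), Thm 1.
-/

namespace Summit.HodgeConjecture.CorCM.Census.IndexTwoDescent

open Finset
open Summit.HodgeConjecture.CorCM.Prior.AllgGroup.RfwfAllgGroup
open Summit.HodgeConjecture.CorCM.Census.BlockParity
open Summit.HodgeConjecture.CorCM.Census.Coinvariant
open Summit.HodgeConjecture.CorCM.Census.TwistGeneration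

noncomputable section

variable {G : Type*} [Group G] [Fintype G] [DecidableEq G] {c : G}
variable {H : Subgroup G} [DecidablePred (· ∈ H)]

/-! ## §1 Marginals of the base change along `x` -/

/-- **`marg₁ (y·x⁻¹) = (pushTwist)_* (marg₀ y)`**: the base change along `x` moves the `0`-marginal to the `1`-marginal (up to the twist).
[folklore] -/
theorem marg₁_mapDomain_rt_x (hcH : c ∈ H) (hcen : ∀ g : G, g * c = c * g) (hH : H.index = 2) {x : G} (hx : x ∉ H)
    (y : CMF G c →₀ ℤ) :
    marg₁ hcH hcen x (Finsupp.mapDomain (rt c x) y) = Finsupp.mapDomain (pushTwist hcH hcen hH hx) (marg₀ hcH y) := by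
  induction y using Finsupp.induction_linear with
  | zero => simp
  | add y z hy hz => rw [Finsupp.mapDomain_add, map_add, map_add, Finsupp.mapDomain_add, hy, hz]
  | single Ψ n => rw [Finsupp.mapDomain_single, marg₁_single, marg₀_single, Finsupp.mapDomain_single, res₁_rt_x hcH hcen hH hx]

/-- **`marg₀ (y·x⁻¹) = (conjPull)_* (marg₁ y)`.** [folklore] -/
theorem marg₀_mapDomain_rt_x (hcH : c ∈ H) (hcen : ∀ g : G, g * c = c * g) (hH : H.index = 2) (x : G) (y : CMF G c →₀ ℤ) :
    marg₀ hcH (Finsupp.mapDomain (rt c x) y) = Finsupp.mapDomain (conjPull hcH hcen hH x) (marg₁ hcH hcen x y) := by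
  induction y using Finsupp.induction_linear with
  | zero => simp
  | add y z hy hz => rw [Finsupp.mapDomain_add, map_add, map_add, Finsupp.mapDomain_add, hy, hz]
  | single Ψ n => rw [Finsupp.mapDomain_single, marg₁_single, marg₀_single, Finsupp.mapDomain_single, res₀_rt_x hcH hcen hH x]

/-- A vector with zero `0`-marginal has, after the base change along `x`, zero `1`-marginal. [folklore] -/
theorem marg₁_mapDomain_rt_x_eq_zero (hcH : c ∈ H) (hcen : ∀ g : G, g * c = c * g) (hH : H.index = 2) {x : G} (hx : x ∉ H)
    {y : CMF G c →₀ ℤ} (hy : marg₀ hcH y = 0) : marg₁ hcH hcen x (Finsupp.mapDomain (rt c x) y) = 0 := by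
  rw [marg₁_mapDomain_rt_x hcH hcen hH hx, hy, Finsupp.mapDomain_zero]

omit [DecidablePred (· ∈ H)] in
/-- Undoing a base change: `(y·x⁻¹)·x = y`. [folklore] -/
theorem mapDomain_rt_inv_mapDomain_rt (x : G) (y : CMF G c →₀ ℤ) :
    Finsupp.mapDomain (rt c x⁻¹) (Finsupp.mapDomain (rt c x) y) = y := by
  rw [← Finsupp.mapDomain_comp]
  have h : rt c x⁻¹ ∘ rt c x = id := funext fun Ψ => rt_inv_rt c x Ψ
  rw [h, Finsupp.mapDomain_id]

omit [DecidablePred (· ∈ H)] in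
/-- For central `c`, **`ℤ⟨pairs⟩` is base-change stable.** [folklore] -/
theorem mapDomain_rt_mem_span_pairSet (hcen : ∀ g : G, g * c = c * g) (Q : G) {y : CMF G c →₀ ℤ}
    (hy : y ∈ Submodule.span ℤ (pairSet c)) : Finsupp.mapDomain (rt c Q) y ∈ Submodule.span ℤ (pairSet c) := by
  have h := mapDomain_rt_mem_psp c hcen Q (∅ : Finset (CMF G c →₀ ℤ)) (Submodule.mem_sup_left hy)
  have he : translates c (∅ : Finset (CMF G c →₀ ℤ)) = ∅ := by
    ext z; simp [translates]
  rwa [he, Submodule.span_empty, sup_bot_eq] at h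

/-! ## §2 The three lifting lemmas -/

/-- **Lifting translates**: if every `f ∈ S` has a lift `F ∈ M` with marginals `(f, 0)` and `M` is stable under base change along `H`, then every
element of `ℤ⟨translates S⟩` has a lift in `M` with marginals `(·, 0)`. [folklore] -/
theorem exists_lift_of_mem_span_translates (hcH : c ∈ H) (hcen : ∀ g : G, g * c = c * g) (x : G) (S : Finset (CMF H ⟨c, hcH⟩ →₀ ℤ))
    (M : Submodule ℤ (CMF G c →₀ ℤ)) (hM : ∀ h : H, ∀ y ∈ M, Finsupp.mapDomain (rt c (h : G)) y ∈ M)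
    (hlift : ∀ f ∈ S, ∃ F ∈ M, marg₀ hcH F = f ∧ marg₁ hcH hcen x F = 0) {q : CMF H ⟨c, hcH⟩ →₀ ℤ}
    (hq : q ∈ Submodule.span ℤ (translates (⟨c, hcH⟩ : H) S)) :
    ∃ w ∈ M, marg₀ hcH w = q ∧ marg₁ hcH hcen x w = 0 := by
  induction hq using Submodule.span_induction with
  | mem q hq =>
    obtain ⟨h, f, hf, rfl⟩ := hq
    obtain ⟨F, hFM, hF0, hF1⟩ := hlift f hf
    exact ⟨Finsupp.mapDomain (rt c (h : G)) F, hM h F hFM, by rw [marg₀_mapDomain_rt_coe, hF0],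
      by rw [marg₁_mapDomain_rt_coe, hF1, Finsupp.mapDomain_zero]⟩
  | zero => exact ⟨0, Submodule.zero_mem _, by rw [map_zero], by rw [map_zero]⟩
  | add q q' _ _ hq hq' =>
    obtain ⟨w, hw, hw0, hw1⟩ := hq
    obtain ⟨w', hw', hw0', hw1'⟩ := hq'
    exact ⟨w + w', Submodule.add_mem _ hw hw', by rw [map_add, hw0, hw0'], by rw [map_add, hw1, hw1', add_zero]⟩
  | smul a q _ hq =>
    obtain ⟨w, hw, hw0, hw1⟩ := hq
    exact ⟨a • w, Submodule.smul_mem _ a hw, by rw [map_smul, hw0], by rw [map_smul, hw1, smul_zero]⟩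

/-- **Lifting pairs, free `1`-marginal**: every element of `ℤ⟨pairs of H⟩` is the `0`-marginal of an element of `ℤ⟨pairs of G⟩`. [folklore] -/
theorem exists_pair_lift_of_mem_span_pairSet (hcH : c ∈ H) (hcen : ∀ g : G, g * c = c * g) (hH : H.index = 2) {x : G} (hx : x ∉ H)
    {p : CMF H ⟨c, hcH⟩ →₀ ℤ} (hp : p ∈ Submodule.span ℤ (pairSet (⟨c, hcH⟩ : H))) :
    ∃ w ∈ Submodule.span ℤ (pairSet c), marg₀ hcH w = p := by
  induction hp using Submodule.span_induction with
  | mem p hp =>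
    obtain ⟨T, rfl⟩ := hp
    refine ⟨pair c (glue hcH hcen hH hx T T), Submodule.subset_span (pair_mem_pairSet c _), ?_⟩
    rw [marg₀_pair, res₀_glue]
  | zero => exact ⟨0, Submodule.zero_mem _, by rw [map_zero]⟩
  | add p p' _ _ hp hp' =>
    obtain ⟨w, hw, hw0⟩ := hp
    obtain ⟨w', hw', hw0'⟩ := hp'
    exact ⟨w + w', Submodule.add_mem _ hw hw', by rw [map_add, hw0, hw0']⟩
  | smul a p _ hp =>
    obtain ⟨w, hw, hw0⟩ := hp
    exact ⟨a • w, Submodule.smul_mem _ a hw, by rw [map_smul, hw0]⟩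

/-- **Lifting pairs, `1`-marginal pinned**: every `p ∈ ℤ⟨pairs of H⟩` is, up to a multiple `N·pair T⋆` of one fixed pair, the `0`-marginal of an
element of `ℤ⟨pairs of G⟩` with ZERO `1`-marginal (differences `pair (glue T B) − pair (glue T⋆ B)`). [folklore] -/
theorem exists_pair_lift_sub_of_mem_span_pairSet (hcH : c ∈ H) (hcen : ∀ g : G, g * c = c * g) (hH : H.index = 2) {x : G} (hx : x ∉ H)
    (Tstar B : CMF H ⟨c, hcH⟩) {p : CMF H ⟨c, hcH⟩ →₀ ℤ} (hp : p ∈ Submodule.span ℤ (pairSet (⟨c, hcH⟩ : H))) :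
    ∃ w ∈ Submodule.span ℤ (pairSet c), ∃ N : ℤ, marg₀ hcH w + N • pair (⟨c, hcH⟩ : H) Tstar = p ∧ marg₁ hcH hcen x w = 0 := by
  induction hp using Submodule.span_induction with
  | mem p hp =>
    obtain ⟨T, rfl⟩ := hp
    refine ⟨pair c (glue hcH hcen hH hx T B) - pair c (glue hcH hcen hH hx Tstar B),
      Submodule.sub_mem _ (Submodule.subset_span (pair_mem_pairSet c _)) (Submodule.subset_span (pair_mem_pairSet c _)), 1, ?_, ?_⟩
    · rw [map_sub, marg₀_pair, marg₀_pair, res₀_glue, res₀_glue, one_smul, sub_add_cancel]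
    · rw [map_sub, marg₁_pair, marg₁_pair, res₁_glue, res₁_glue, sub_self]
  | zero => exact ⟨0, Submodule.zero_mem _, 0, by rw [map_zero, zero_smul, zero_add], by rw [map_zero]⟩
  | add p p' _ _ hp hp' =>
    obtain ⟨w, hw, N, hw0, hw1⟩ := hp
    obtain ⟨w', hw', N', hw0', hw1'⟩ := hp'
    refine ⟨w + w', Submodule.add_mem _ hw hw', N + N', ?_, by rw [map_add, hw1, hw1', add_zero]⟩
    rw [map_add, add_smul, ← hw0, ← hw0']
    abel
  | smul a p _ hp =>
    obtain ⟨w, hw, N, hw0, hw1⟩ := hp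
    refine ⟨a • w, Submodule.smul_mem _ a hw, a * N, ?_, by rw [map_smul, hw1, smul_zero]⟩
    rw [map_smul, mul_smul, ← smul_add, hw0]

/-- The type sum detects the multiple of a pair: `typeSum (N • pair T) h = N`. [folklore] -/
theorem typeSum_smul_pair (hcH : c ∈ H) (hcen : ∀ g : G, g * c = c * g) (N : ℤ) (T : CMF H ⟨c, hcH⟩) (h : H) :
    typeSum H (⟨c, hcH⟩ : H) (N • pair (⟨c, hcH⟩ : H) T) h = N := by
  rw [map_smul, Pi.smul_apply, typeSum_pair _ (csub_comm hcH hcen), smul_eq_mul, mul_one]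

/-! ## §3 The lifting theorem -/

/-- **THE INDEX-TWO LIFTING THEOREM.**  Let `c ≠ 1` be a central involution, `H ∋ c` of index two, `x ∉ H`.  Suppose the Hodge lattice of `(H, c)`
is generated modulo pairs by the base changes of a finite family `S`, and that every `f ∈ S` has a LIFT `F` — `marg₀ F = f`, `marg₁ F = 0` — inside a
submodule `M ≤ hodgeSpan (G, c)` stable under all base changes of `G`.  Then
**`hodgeSpan (G, c) ≤ (ℤ⟨pairs⟩ ⊔ M) ⊔ (ker marg₀ ⊓ ker marg₁)`** — the Hodge lattice of `G` is generated by pairs, `M`, and bi-marginal-zero vectors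
(= mixed faces, `span_mixed_eq`). [folklore] -/
theorem hodgeSpan_le_sup_ker_of_lifts (hcH : c ∈ H) (hc2 : c * c = 1) (hc1 : c ≠ 1) (hcen : ∀ g : G, g * c = c * g) (hH : H.index = 2)
    {x : G} (hx : x ∉ H) (S : Finset (CMF H ⟨c, hcH⟩ →₀ ℤ))
    (hS : hodgeSpan (⟨c, hcH⟩ : H) (csub_mul_csub hcH hc2) ≤
      Submodule.span ℤ (pairSet (⟨c, hcH⟩ : H)) ⊔ Submodule.span ℤ (translates (⟨c, hcH⟩ : H) S))
    (M : Submodule ℤ (CMF G c →₀ ℤ)) (hMH : M ≤ hodgeSpan c hc2) (hM : ∀ Q : G, ∀ y ∈ M, Finsupp.mapDomain (rt c Q) y ∈ M)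
    (hlift : ∀ f ∈ S, ∃ F ∈ M, marg₀ hcH F = f ∧ marg₁ hcH hcen x F = 0) :
    hodgeSpan c hc2 ≤ (Submodule.span ℤ (pairSet c) ⊔ M) ⊔ (LinearMap.ker (marg₀ hcH) ⊓ LinearMap.ker (marg₁ hcH hcen x)) := by
  intro y hy
  obtain ⟨Φ₀, hΦ₀⟩ := exists_isCMF c hc2 hc1
  set Ψ₀ : CMF G c := ⟨Φ₀, hΦ₀⟩
  have hMH' : ∀ h : H, ∀ y ∈ M, Finsupp.mapDomain (rt c (h : G)) y ∈ M := fun h y hy => hM h y hy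
  have hPH : Submodule.span ℤ (pairSet c) ≤ hodgeSpan c hc2 := le_sup_right
  -- Step 1: kill the `0`-marginal of `y`.
  obtain ⟨p, hp, q, hq, hpq⟩ := Submodule.mem_sup.mp (hS (marg_mem_hodgeSpan hcH hc2 hc1 hcen x hy).1)
  obtain ⟨wq, hwqM, hwq0, hwq1⟩ := exists_lift_of_mem_span_translates hcH hcen x S M hMH' hlift hq
  obtain ⟨wp, hwpP, hwp0⟩ := exists_pair_lift_of_mem_span_pairSet hcH hcen hH hx hp
  set y₁ := y - wq - wp with hy₁def
  have hy₁H : y₁ ∈ hodgeSpan c hc2 := Submodule.sub_mem _ (Submodule.sub_mem _ hy (hMH hwqM)) (hPH hwpP)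
  have hy₁0 : marg₀ hcH y₁ = 0 := by
    rw [hy₁def, map_sub, map_sub, hwq0, hwp0, ← hpq]; abel
  -- Step 2: move to `z = y₁·x⁻¹`, which has zero `1`-marginal.
  set z := Finsupp.mapDomain (rt c x) y₁ with hzdef
  have hzH : z ∈ hodgeSpan c hc2 := mapDomain_rt_mem_hodgeSpan c hc2 hcen x hy₁H
  have hz1 : marg₁ hcH hcen x z = 0 := marg₁_mapDomain_rt_x_eq_zero hcH hcen hH hx hy₁0
  -- Step 3: kill the `0`-marginal of `z` keeping the `1`-marginal zero.
  obtain ⟨p', hp', q', hq', hpq'⟩ := Submodule.mem_sup.mp (hS (marg_mem_hodgeSpan hcH hc2 hc1 hcen x hzH).1)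
  obtain ⟨wq', hwq'M, hwq'0, hwq'1⟩ := exists_lift_of_mem_span_translates hcH hcen x S M hMH' hlift hq'
  obtain ⟨wp', hwp'P, N, hwp'0, hwp'1⟩ :=
    exists_pair_lift_sub_of_mem_span_pairSet hcH hcen hH hx (res₀ hcH Ψ₀) (res₀ hcH Ψ₀) hp'
  set z₂ := z - wq' - wp' with hz₂def
  have hz₂H : z₂ ∈ hodgeSpan c hc2 := Submodule.sub_mem _ (Submodule.sub_mem _ hzH (hMH hwq'M)) (hPH hwp'P)
  have hz₂1 : marg₁ hcH hcen x z₂ = 0 := by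
    rw [hz₂def, map_sub, map_sub, hz1, hwq'1, hwp'1, sub_zero, sub_zero]
  have hz₂0' : marg₀ hcH z₂ = N • pair (⟨c, hcH⟩ : H) (res₀ hcH Ψ₀) := by
    rw [hz₂def, map_sub, map_sub, hwq'0, ← hpq', ← hwp'0]; abel
  -- the constant type sum of `z₂` vanishes on `xH`, hence on `H`, hence `N = 0`
  have hN : N = 0 := by
    obtain ⟨k, hk⟩ := exists_forall_typeSum_eq_of_mem_hodgeSpan c hc2 hcen hz₂H
    have hk0 : k = 0 := by
      have h := typeSum_marg₁ hcH hcen x z₂ (1 : H)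
      rw [hz₂1, map_zero, Pi.zero_apply, hk] at h
      exact h.symm
    have h := typeSum_marg₀ hcH z₂ (1 : H)
    rw [hz₂0', typeSum_smul_pair hcH hcen, hk, hk0] at h
    exact h
  have hz₂0 : marg₀ hcH z₂ = 0 := by rw [hz₂0', hN, zero_smul]
  have hz₂Z : z₂ ∈ LinearMap.ker (marg₀ hcH) ⊓ LinearMap.ker (marg₁ hcH hcen x) :=
    ⟨LinearMap.mem_ker.mpr hz₂0, LinearMap.mem_ker.mpr hz₂1⟩
  -- Step 4: move back.
  have hzsum : z₂ + wq' + wp' = z := by rw [hz₂def]; abel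
  have hy₁eq : y₁ = Finsupp.mapDomain (rt c x⁻¹) z₂ + Finsupp.mapDomain (rt c x⁻¹) wq' + Finsupp.mapDomain (rt c x⁻¹) wp' := by
    rw [← Finsupp.mapDomain_add, ← Finsupp.mapDomain_add, hzsum, hzdef, mapDomain_rt_inv_mapDomain_rt]
  have hy₁mem : y₁ ∈ (Submodule.span ℤ (pairSet c) ⊔ M) ⊔ (LinearMap.ker (marg₀ hcH) ⊓ LinearMap.ker (marg₁ hcH hcen x)) := by
    rw [hy₁eq]
    refine Submodule.add_mem _ (Submodule.add_mem _ ?_ ?_) ?_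
    · exact Submodule.mem_sup_right (mapDomain_rt_mem_ker_inf_ker hcH hcen hc2 hH hx Ψ₀ x⁻¹ hz₂Z)
    · exact Submodule.mem_sup_left (Submodule.mem_sup_right (hM x⁻¹ wq' hwq'M))
    · exact Submodule.mem_sup_left (Submodule.mem_sup_left (mapDomain_rt_mem_span_pairSet hcen x⁻¹ hwp'P))
  have hyeq : y = y₁ + wq + wp := by rw [hy₁def]; abel
  rw [hyeq]
  exact Submodule.add_mem _ (Submodule.add_mem _ hy₁mem (Submodule.mem_sup_left (Submodule.mem_sup_right hwqM)))
    (Submodule.mem_sup_left (Submodule.mem_sup_left hwpP))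

/-- **The lifting theorem, mixed-face form**: under the same hypotheses, `hodgeSpan (G, c) ≤ (ℤ⟨pairs⟩ ⊔ M) ⊔ ℤ⟨mixed faces⟩`. [folklore] -/
theorem hodgeSpan_le_sup_mixed_of_lifts (hcH : c ∈ H) (hc2 : c * c = 1) (hc1 : c ≠ 1) (hcen : ∀ g : G, g * c = c * g) (hH : H.index = 2)
    {x : G} (hx : x ∉ H) (S : Finset (CMF H ⟨c, hcH⟩ →₀ ℤ))
    (hS : hodgeSpan (⟨c, hcH⟩ : H) (csub_mul_csub hcH hc2) ≤
      Submodule.span ℤ (pairSet (⟨c, hcH⟩ : H)) ⊔ Submodule.span ℤ (translates (⟨c, hcH⟩ : H) S))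
    (M : Submodule ℤ (CMF G c →₀ ℤ)) (hMH : M ≤ hodgeSpan c hc2) (hM : ∀ Q : G, ∀ y ∈ M, Finsupp.mapDomain (rt c Q) y ∈ M)
    (hlift : ∀ f ∈ S, ∃ F ∈ M, marg₀ hcH F = f ∧ marg₁ hcH hcen x F = 0) :
    hodgeSpan c hc2 ≤ (Submodule.span ℤ (pairSet c) ⊔ M) ⊔ Submodule.span ℤ (mixedSet c hc2 H x) := by
  obtain ⟨Φ₀, hΦ₀⟩ := exists_isCMF c hc2 hc1
  rw [span_mixed_eq hcH hcen hc2 hH hx ⟨Φ₀, hΦ₀⟩]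
  exact hodgeSpan_le_sup_ker_of_lifts hcH hc2 hc1 hcen hH hx S hS M hMH hM hlift

/-! ## §4 The face form: lifts of faces are faces at diagonal types -/

/-- **The lift of a face of `H`** is the same face in the `0`-coordinate at the DIAGONAL type: `marg₀ (gface (glue T T) t t') = gface T t t'`
(the background `T` in the `1`-coordinate is a bookkeeping choice; any background lifts). [folklore] -/
theorem marg₀_gface_glue (hcH : c ∈ H) (hcen : ∀ g : G, g * c = c * g) (hc2 : c * c = 1) (hH : H.index = 2) {x : G} (hx : x ∉ H)
    (T : CMF H ⟨c, hcH⟩) (t t' : H) :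
    marg₀ hcH (gface c hc2 (glue hcH hcen hH hx T T) (t : G) (t' : G)) = gface (⟨c, hcH⟩ : H) (csub_mul_csub hcH hc2) T t t' := by
  rw [marg₀_gface_coe_coe, res₀_glue]

/-- The lifted face of a face of `H` (distinct places) is a face of `G`. [folklore] -/
theorem gface_glue_mem_gfaceSet (hcH : c ∈ H) (hcen : ∀ g : G, g * c = c * g) (hc2 : c * c = 1) (hH : H.index = 2) {x : G} (hx : x ∉ H)
    (T : CMF H ⟨c, hcH⟩) {t t' : H} (ht' : t' ∉ orb (⟨c, hcH⟩ : H) t) :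
    gface c hc2 (glue hcH hcen hH hx T T) (t : G) (t' : G) ∈ gfaceSet G c hc2 :=
  ⟨glue hcH hcen hH hx T T, t, t', fun h => ht' ((coe_mem_orb_coe_iff hcH t t').mp h), rfl⟩

omit [DecidablePred (· ∈ H)] in
/-- Translates of faces lie in the Hodge lattice. [folklore] -/
theorem span_translates_le_hodgeSpan (hc2 : c * c = 1) (𝓕 : Finset (CMF G c →₀ ℤ)) (h𝓕 : (𝓕 : Set (CMF G c →₀ ℤ)) ⊆ gfaceSet G c hc2) :
    Submodule.span ℤ (translates c 𝓕) ≤ hodgeSpan c hc2 := by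
  rw [Submodule.span_le]
  rintro _ ⟨Q, s, hs, rfl⟩
  exact Submodule.mem_sup_left (mapDomain_rt_mem_span_gfaceSet c hc2 Q (Submodule.subset_span (h𝓕 (Finset.mem_coe.mpr hs))))

/-- **THE INDEX-TWO LIFTING THEOREM, FACE FORM — `μ(G, c) ≤ μ(H, c) + μ_mixed(G, c)`.**  For every central involution `c ≠ 1`, every subgroup
`H ∋ c` of index two, every `x ∉ H` and every finite family `S` of faces of `(H, c)` whose base changes generate `hodgeSpan (H, c)` modulo pairs,
there is a family `𝓕` of faces of `(G, c)` with `|𝓕| ≤ |S|` such that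
`hodgeSpan (G, c) ≤ (ℤ⟨pairs⟩ ⊔ ℤ⟨translates 𝓕⟩) ⊔ ℤ⟨mixed faces⟩`. [folklore] -/
theorem exists_lifts_hodgeSpan_le (hcH : c ∈ H) (hc2 : c * c = 1) (hc1 : c ≠ 1) (hcen : ∀ g : G, g * c = c * g) (hH : H.index = 2)
    {x : G} (hx : x ∉ H) (S : Finset (CMF H ⟨c, hcH⟩ →₀ ℤ)) (hSf : (S : Set (CMF H ⟨c, hcH⟩ →₀ ℤ)) ⊆ gfaceSet H ⟨c, hcH⟩ (csub_mul_csub hcH hc2))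
    (hS : hodgeSpan (⟨c, hcH⟩ : H) (csub_mul_csub hcH hc2) ≤
      Submodule.span ℤ (pairSet (⟨c, hcH⟩ : H)) ⊔ Submodule.span ℤ (translates (⟨c, hcH⟩ : H) S)) :
    ∃ 𝓕 : Finset (CMF G c →₀ ℤ), (𝓕 : Set (CMF G c →₀ ℤ)) ⊆ gfaceSet G c hc2 ∧ 𝓕.card ≤ S.card ∧
      hodgeSpan c hc2 ≤ (Submodule.span ℤ (pairSet c) ⊔ Submodule.span ℤ (translates c 𝓕)) ⊔ Submodule.span ℤ (mixedSet c hc2 H x) := by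
  classical
  -- the lift, defined by choice on the face data
  let L : (CMF H ⟨c, hcH⟩ →₀ ℤ) → (CMF G c →₀ ℤ) := fun f =>
    if hf : f ∈ gfaceSet H ⟨c, hcH⟩ (csub_mul_csub hcH hc2) then
      gface c hc2 (glue hcH hcen hH hx hf.choose hf.choose) (hf.choose_spec.choose : G) (hf.choose_spec.choose_spec.choose : G)
    else 0
  have hL : ∀ f, (hf : f ∈ gfaceSet H ⟨c, hcH⟩ (csub_mul_csub hcH hc2)) →
      L f ∈ gfaceSet G c hc2 ∧ marg₀ hcH (L f) = f ∧ marg₁ hcH hcen x (L f) = 0 := by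
    intro f hf
    have hspec := hf.choose_spec.choose_spec.choose_spec
    simp only [L, dif_pos hf]
    refine ⟨gface_glue_mem_gfaceSet hcH hcen hc2 hH hx _ hspec.1, ?_, marg₁_gface_coe_coe hcH hcen hc2 hx _ _ _⟩
    rw [marg₀_gface_glue, ← hspec.2]
  refine ⟨S.image L, ?_, Finset.card_image_le, ?_⟩
  · intro F hF
    obtain ⟨f, hf, rfl⟩ := Finset.mem_image.mp (Finset.mem_coe.mp hF)
    exact (hL f (hSf (Finset.mem_coe.mpr hf))).1
  · refine hodgeSpan_le_sup_mixed_of_lifts hcH hc2 hc1 hcen hH hx S hS (Submodule.span ℤ (translates c (S.image L)))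
      (span_translates_le_hodgeSpan hc2 _ ?_) (fun Q y hy => mapDomain_rt_mem_span_translates c Q _ hy) ?_
    · intro F hF
      obtain ⟨f, hf, rfl⟩ := Finset.mem_image.mp (Finset.mem_coe.mp hF)
      exact (hL f (hSf (Finset.mem_coe.mpr hf))).1
    · intro f hf
      have h := hL f (hSf (Finset.mem_coe.mpr hf))
      exact ⟨L f, mem_span_translates_of_mem c _ (Finset.mem_image_of_mem L hf), h.2.1, h.2.2⟩

end

end Summit.HodgeConjecture.CorCM.Census.IndexTwoDescent
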